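import Mathlib

/-!
# A kernel-checked counterexample to the vdBHK (2006) mixed-graph conjecture (blind cell PercRepro2, lead)

van den Berg–Häggström–Kahn, *Some conditional correlation inequalities for percolation and related
processes*, Random Structures & Algorithms 29 (2006), Theorem 3.4 (directed graphs): for independent
arcs, `s ≠ t`, `C_v` the set of open arcs lying on open oriented paths from `v`, `V(F)` the vertices
incident with `F`, `Q := {V(C_s) ∩ V(C_t) = ∅}`, and `f, g` functions of `(C_s, C_t)` with `f`
increasing in `C_s` and decreasing in `C_t`, `g` decreasing in `C_s` and increasing in `C_t`
(here `f = 1[1 ∈ V(C_s)]`, `g = 1[6 ∉ V(C_t)]`), one has `E[fg | Q] ≥ E[f | Q]·E[g | Q]`.  The paper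
conjectures (p. 18) that the theorem «remains true without the restriction» that all edges are
directed, i.e. for MIXED graphs (undirected edges usable in both directions).

This file checks in the kernel that the conjecture is FALSE: on the mixed graph `W1e7` on the
vertices `0..6` with `s = 5`, `t = 0`, undirected edges `{4,5}`, `{0,3}` (probability `1`),
`{0,6}`, `{1,2}` (probability `1/2`), and arcs `(2,3)` (probability `7/8`), `(1,4)`, `(4,1)`, `(6,2)`
(probability `1/2`),

  `P(Q) = 95/128`, `E[f;Q] = 35/128`, `E[g;Q] = 50/128`, `E[fg;Q] = 18/128`,
  `E[fg | Q] − E[f | Q]·E[g | Q] = 18/95 − (7/19)(10/19) = −8/1805 < 0`.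

Everything is a finite sum over the `2^8` edge configurations with integer weights in units of
`8^{-8}` (`massQ = 95·8^8/128`, …); the four masses are established by `decide` (kernel evaluation,
standard axioms only) and the inequality follows by `norm_num`.  Found by the cell's exploration-lens
adversary (NEGATIVE.md NEG-76); re-derived exactly by three independent implementations.
-/

namespace Summit.Ventures.PercRepro2.BHKMixed

/-- An edge of a mixed graph: `arc = true` means the arc `u → v`, `arc = false` the undirected edge
`{u, v}`; the edge is open with probability `w / 8`. -/
structure MEdge where
  arc : Bool
  u : Nat
  v : Nat
  w : Nat

/-- The eight edges of the witness `W1e7` (vertices `0..6`). -/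
def edge : Nat → MEdge
  | 0 => ⟨false, 4, 5, 8⟩   -- {4,5}, p = 1
  | 1 => ⟨false, 0, 3, 8⟩   -- {0,3}, p = 1
  | 2 => ⟨true,  2, 3, 7⟩   -- (2,3), p = 7/8
  | 3 => ⟨false, 0, 6, 4⟩   -- {0,6}, p = 1/2
  | 4 => ⟨false, 1, 2, 4⟩   -- {1,2}, p = 1/2
  | 5 => ⟨true,  1, 4, 4⟩   -- (1,4), p = 1/2
  | 6 => ⟨true,  4, 1, 4⟩   -- (4,1), p = 1/2
  | _ => ⟨true,  6, 2, 4⟩   -- (6,2), p = 1/2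

/-- The source `s = 5`. -/
def s : Nat := 5
/-- The target `t = 0`. -/
def t : Nat := 0

/-- Edge `i` is open in the configuration `c ∈ [0, 2^8)` iff bit `i` of `c` is set. -/
def isOpen (c i : Nat) : Bool := c.testBit i

/-- Product Bernoulli weight of the configuration `c`, in units of `8^{-8}`:
`∏_i (w_i if open else 8 − w_i)`. -/
def wt (c : Nat) : Nat :=
  (List.range 8).foldl (fun acc i => acc * (if isOpen c i then (edge i).w else 8 - (edge i).w)) 1

/-- Vertex sets are bitmasks over `0..6`; `mem S x` is `x ∈ S`. -/
def mem (S x : Nat) : Bool := S.testBit x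

/-- One expansion step of a vertex set along the open edges (arcs forward only, undirected edges
both ways). -/
def step (c S : Nat) : Nat :=
  (List.range 8).foldl (fun S i =>
    let e := edge i
    if isOpen c i then
      let S₁ := if mem S e.u then S ||| (1 <<< e.v) else S
      if e.arc then S₁ else (if mem S₁ e.v then S₁ ||| (1 <<< e.u) else S₁)
    else S) S

/-- `n`-fold iteration of `step c`. -/
def iter (c : Nat) : Nat → Nat → Nat
  | 0, S => S
  | n + 1, S => iter c n (step c S)

/-- `R(v)`: the vertices reachable from `v` by open oriented paths (`v` included); seven steps
suffice on seven vertices. -/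
def reach (c v : Nat) : Nat := iter c 7 (1 <<< v)

/-- `V(C_v)` in the paper's sense: the endpoints of the open edges lying on an open oriented path
from `v`, i.e. of the open edges usable from a vertex of `R(v)`. -/
def VC (c v : Nat) : Nat :=
  let R := reach c v
  (List.range 8).foldl (fun S i =>
    let e := edge i
    if isOpen c i && (mem R e.u || (!e.arc && mem R e.v)) then S ||| (1 <<< e.u) ||| (1 <<< e.v)
    else S) 0

/-- The conditioning event `Q = {V(C_s) ∩ V(C_t) = ∅}`. -/
def Q (c : Nat) : Bool := (VC c s &&& VC c t) == 0
/-- `f = 1[1 ∈ V(C_s)]` — increasing in `C_s`, constant in `C_t`. -/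
def f (c : Nat) : Bool := mem (VC c s) 1
/-- `g = 1[6 ∉ V(C_t)]` — constant in `C_s`, decreasing in `C_t`. -/
def g (c : Nat) : Bool := !(mem (VC c t) 6)

/-- `8^8 · P(Q)`. -/
def massQ : Nat := (List.range 256).foldl (fun a c => if Q c then a + wt c else a) 0
/-- `8^8 · E[f; Q]`. -/
def massfQ : Nat := (List.range 256).foldl (fun a c => if Q c && f c then a + wt c else a) 0
/-- `8^8 · E[g; Q]`. -/
def massgQ : Nat := (List.range 256).foldl (fun a c => if Q c && g c then a + wt c else a) 0
/-- `8^8 · E[fg; Q]`. -/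
def massfgQ : Nat := (List.range 256).foldl (fun a c => if Q c && f c && g c then a + wt c else a) 0

/-- Total mass `8^8` (sanity: the weights sum to one). -/
theorem total_mass : (List.range 256).foldl (fun a c => a + wt c) 0 = 8 ^ 8 := by decide +kernel

/-- `8^8 · P(Q) = 95 · 8^8 / 128`. -/
theorem massQ_eq : massQ = 12451840 := by decide +kernel
/-- `8^8 · E[f; Q] = 35 · 8^8 / 128`. -/
theorem massfQ_eq : massfQ = 4587520 := by decide +kernel
/-- `8^8 · E[g; Q] = 50 · 8^8 / 128`. -/
theorem massgQ_eq : massgQ = 6553600 := by decide +kernel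
/-- `8^8 · E[fg; Q] = 18 · 8^8 / 128`. -/
theorem massfgQ_eq : massfgQ = 2359296 := by decide +kernel

/-- `P(Q) = 95/128`. -/
theorem probQ : (massQ : ℚ) / 8 ^ 8 = 95 / 128 := by rw [massQ_eq]; norm_num

/-- The conditional covariance on `Q` is `−8/1805 < 0`. -/
theorem conditional_covariance :
    (massfgQ : ℚ) / massQ - (massfQ / massQ) * (massgQ / massQ) = -8 / 1805 := by
  rw [massQ_eq, massfQ_eq, massgQ_eq, massfgQ_eq]; norm_num

/-- `E[fg | Q] < E[f | Q] · E[g | Q]` on the mixed graph `W1e7`: the vdBHK mixed-graph conjecture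
(Theorem 3.4 «without the restriction» to directed edges) is false. -/
theorem vdBHK_mixed_conjecture_false :
    (massfgQ : ℚ) / massQ < (massfQ / massQ) * (massgQ / massQ) := by
  rw [massQ_eq, massfQ_eq, massgQ_eq, massfgQ_eq]; norm_num

/-- Equivalently, `E[f | g = 1, Q] = 9/25 < 17/45 = E[f | g = 0, Q]`. -/
theorem conditional_on_g :
    (massfgQ : ℚ) / massgQ = 9 / 25 ∧ ((massfQ : ℚ) - massfgQ) / (massQ - massgQ) = 17 / 45 := by
  rw [massQ_eq, massfQ_eq, massgQ_eq, massfgQ_eq]; norm_num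

end Summit.Ventures.PercRepro2.BHKMixed
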